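import Summits.ValiantsHypothesis.ValiantsHypothesis.Theses.SOSTau

/-!
# Strategist sketch, generation 1, for crux `SOSTau` (stmt-ValiantsHypothesis-18748) — signatures quoted in
STRATEGY-CENSUS.md (gen 1 sections).  Companion of gen 0's `CensusSketch.lean` (namespace `…Census`); nothing here is
registered as a line.

What is PROVED here (sorry-free):
* `natDegree_map_tavenasV`, `neg_of_mem_roots_map_tavenasV` — the route's witness `V_n` is NEGATIVE-ROOTED with simple
  roots (all `2^n − 1` roots real, simple, `< 0`);
* `target_of_negRooted : NegRootedSOS → HutchinsonSOSHard` — the route's target (hence `closes`, via the proved crux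
  `HutchinsonMagnification`) needs ONLY the negative-rooted slice of SOS-τ, a statement strictly weaker than the crux;
* the chain `Crux → SimpleRealRootedSOS → NegRootedSOS`, `NegRootedSOSRigidity → NegRootedSOS` (c = 2),
  `Crux → PosCoeffSOSTau`, `Crux → CommonSupportSOS`, `Crux → ThreeSquaresPPM` (first rungs / normal forms);
* the `s ≤ 2` cases of the rigidity form in the slice: `negRooted_oneSquare_rigidity` (deg(a g²) + 2 ≤ 2|supp g|, via the
  Vieta/Newton gap lemma `card_support_of_negRooted`) and `negRooted_twoSquares_rigidity` (deg(a g₁² − b g₂²) + 4 ≤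
  2(|supp g₁| + |supp g₂|) for a, b > 0: both factors √a g₁ ∓ √b g₂ are negative-rooted, hence gap-free with one-signed
  coefficients, which forces nested supports) — in the slice the constant is 2, not Chebyshev's 4.
What is only STATED (conjectures / calibration targets): `NegRootedSOSRigidity` for s ≥ 3, `PosCoeffSOSTau`, `CommonSupportSOS`,
`ThreeSquaresPPM`; and `NegRootedThreeSquaresT4` — the rigidity form for three squares of 4-nomials, VERIFIED by the exact sieve
(kit j026135/j026290/j026309; see SIEVE-RESULTS.md) and stated here as the first landable target (`negRootedThreeSquaresT4_of_rigidity`).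
-/

set_option linter.unusedVariables false
set_option linter.dupNamespace false

namespace Summit.ValiantsHypothesis.ValiantsHypothesis.Cruxes.SOSTau.Census2

open Polynomial
open scoped BigOperators
open Literature.Computability.AlgebraicComplexity (tavenasV vExp card_roots_toFinset_map_tavenasV
  natDegree_tavenasV_lt map_tavenasV map_tavenasV_ne_zero)

/-- The crux, by name. -/
abbrev Crux : Prop := Summit.ValiantsHypothesis.ValiantsHypothesis.Theses.SOSTau.SOSTau

/-- The route's target (rank 0 item stmt-ValiantsHypothesis-18747), by name. -/
abbrev Target : Prop := Summit.ValiantsHypothesis.ValiantsHypothesis.Theses.SOSTau.HutchinsonSOSHard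

/-! ## The witness is negative-rooted with simple roots -/

/-- `deg V_n = 2^n − 1` over `ℝ` (all `2^n − 1` roots are real and simple, so the degree cannot be smaller). -/
theorem natDegree_map_tavenasV (n : ℕ) :
    ((tavenasV n).map (Int.castRingHom ℝ)).natDegree = 2 ^ n - 1 := by
  apply le_antisymm
  · have h1 := natDegree_tavenasV_lt n
    have h2 : ((tavenasV n).map (Int.castRingHom ℝ)).natDegree ≤ (tavenasV n).natDegree := natDegree_map_le
    omega
  · calc 2 ^ n - 1 = ((tavenasV n).map (Int.castRingHom ℝ)).roots.toFinset.card :=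
          (card_roots_toFinset_map_tavenasV n).symm
      _ ≤ Multiset.card ((tavenasV n).map (Int.castRingHom ℝ)).roots := Multiset.toFinset_card_le _
      _ ≤ _ := card_roots' _

/-- Every real root of `V_n` is negative (positive coefficients, constant term `1`). -/
theorem neg_of_mem_roots_map_tavenasV (n : ℕ) (x : ℝ)
    (hx : x ∈ ((tavenasV n).map (Int.castRingHom ℝ)).roots) : x < 0 := by
  rw [mem_roots (map_tavenasV_ne_zero n), IsRoot.def] at hx
  by_contra h
  push Not at h
  have hpos : 0 < ((tavenasV n).map (Int.castRingHom ℝ)).eval x := by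
    rw [map_tavenasV, eval_finsetSum]
    have hterm : ∀ i ∈ Finset.range (2 ^ n), 0 ≤ (C ((2 : ℝ) ^ vExp n i) * X ^ i).eval x := by
      intro i _
      rw [eval_mul, eval_C, eval_pow, eval_X]
      positivity
    have h0 : (0 : ℕ) ∈ Finset.range (2 ^ n) := Finset.mem_range.2 (Nat.two_pow_pos n)
    have hle := Finset.single_le_sum hterm h0
    have hone : (C ((2 : ℝ) ^ vExp n 0) * X ^ 0).eval x = 1 := by
      simp [vExp]
    rw [hone] at hle
    linarith
  linarith

/-! ## TRANSFER (route level): the slice the deciding theorem actually needs -/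

/-- Simple-real-rooted slice of SOS-τ: a weighted sparse SOS all of whose roots are real and simple
(`#distinct real roots = degree`) has degree `≤ c · support-sum`.  A special case of `Crux`. -/
def SimpleRealRootedSOS : Prop :=
  ∃ c : ℕ, ∀ (s : ℕ) (a : Fin s → ℝ) (g : Fin s → ℝ[X]),
    (∑ i, C (a i) * g i ^ 2).roots.toFinset.card = (∑ i, C (a i) * g i ^ 2).natDegree →
      (∑ i, C (a i) * g i ^ 2).natDegree ≤ c * ∑ i, (g i).support.card

/-- Negative-rooted slice (hyperbolic with one-signed roots; exactly the shape of `V_n`): all roots real, simple and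
negative ⟹ degree `≤ c · support-sum`.  Weaker still; this is what `closes` consumes (`target_of_negRooted`). -/
def NegRootedSOS : Prop :=
  ∃ c : ℕ, ∀ (s : ℕ) (a : Fin s → ℝ) (g : Fin s → ℝ[X]),
    (∑ i, C (a i) * g i ^ 2).roots.toFinset.card = (∑ i, C (a i) * g i ^ 2).natDegree →
      (∀ x ∈ (∑ i, C (a i) * g i ^ 2).roots, x < 0) →
        (∑ i, C (a i) * g i ^ 2).natDegree ≤ c * ∑ i, (g i).support.card

theorem simpleRealRooted_of_crux (h : Crux) : SimpleRealRootedSOS := by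
  obtain ⟨c, hc⟩ := h
  exact ⟨c, fun s a g hcard => hcard ▸ hc s a g⟩

theorem negRooted_of_simpleRealRooted (h : SimpleRealRootedSOS) : NegRootedSOS := by
  obtain ⟨c, hc⟩ := h
  exact ⟨c, fun s a g hcard _ => hc s a g hcard⟩

set_option maxHeartbeats 800000 in
/-- **The route needs only the negative-rooted slice.**  `NegRootedSOS → HutchinsonSOSHard` with `η = 1/(2(c+1))`,
`n₀ = 1` (same arithmetic as the route's `closes`; the two extra hypotheses are discharged by
`card_roots_toFinset_map_tavenasV`, `natDegree_map_tavenasV`, `neg_of_mem_roots_map_tavenasV`). -/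
theorem target_of_negRooted (h : NegRootedSOS) : Target := by
  obtain ⟨c, hc⟩ := h
  unfold Target Summit.ValiantsHypothesis.ValiantsHypothesis.Theses.SOSTau.HutchinsonSOSHard
  have hcpos : (0 : ℝ) < 2 * ((c : ℝ) + 1) := by
    have : (0 : ℝ) ≤ c := Nat.cast_nonneg c
    linarith
  refine ⟨1 / (2 * ((c : ℝ) + 1)), by positivity, 1, fun n hn s a g hrep => ?_⟩
  have hdeg : (∑ i, C (a i) * g i ^ 2).natDegree = 2 ^ n - 1 := by rw [hrep, natDegree_map_tavenasV]
  have hcard : (∑ i, C (a i) * g i ^ 2).roots.toFinset.card = (∑ i, C (a i) * g i ^ 2).natDegree := by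
    rw [hrep, natDegree_map_tavenasV, card_roots_toFinset_map_tavenasV]
  have hneg : ∀ x ∈ (∑ i, C (a i) * g i ^ 2).roots, x < 0 := by
    rw [hrep]; exact neg_of_mem_roots_map_tavenasV n
  have hZ := hc s a g hcard hneg
  rw [hdeg] at hZ
  have h1 : (1 : ℕ) ≤ 2 ^ n := Nat.one_le_two_pow
  have hZ' : (2 : ℝ) ^ n - 1 ≤ (c : ℝ) * ∑ i, ((g i).support.card : ℝ) := by
    have := (Nat.cast_le (α := ℝ)).mpr hZ
    push_cast [Nat.cast_sub h1] at this
    exact this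
  have h2 : (2 : ℝ) ≤ 2 ^ n := by
    calc (2 : ℝ) = 2 ^ 1 := by norm_num
      _ ≤ 2 ^ n := pow_le_pow_right₀ (by norm_num) hn
  have hS : 0 ≤ ∑ i, ((g i).support.card : ℝ) := Finset.sum_nonneg fun i _ => Nat.cast_nonneg _
  rw [div_mul_eq_mul_div, one_mul, div_le_iff₀ hcpos]
  nlinarith [mul_nonneg (Nat.cast_nonneg c) hS]

/-- So the whole chain `Crux → SimpleRealRootedSOS → NegRootedSOS → Target` is available; the route's `closes`
could equally be glued as `closes (h : NegRootedSOS) (h₂ : HutchinsonMagnification)`. -/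
theorem target_of_crux' (h : Crux) : Target :=
  target_of_negRooted (negRooted_of_simpleRealRooted (simpleRealRooted_of_crux h))

/-! ## STRENGTHEN (inside the slice): the rigidity form — "hyperbolicity buys no sparsity"

In the negative-rooted slice the pure square `((X+1)^{T-1})²` has `deg + 2 = 2T = 2S`; for `s = 1` this is forced
(`g` must be real-rooted, hence gap-free by Newton: `T = deg g + 1`), and for two squares of opposite sign
`deg + 4 ≤ 2S` (both factors `√a g₁ ± √b g₂` negative-rooted ⟹ gap-free with one-signed coefficients ⟹ one support
contains the other and is full).  Conjectured for all `s`; multiplicity is allowed in the hypothesis (stronger). -/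

/-- Rigidity conjecture: a nonzero weighted sparse SOS with all roots real and negative has `deg F + 2 ≤ 2·S`. -/
def NegRootedSOSRigidity : Prop :=
  ∀ (s : ℕ) (a : Fin s → ℝ) (g : Fin s → ℝ[X]), (∑ i, C (a i) * g i ^ 2) ≠ 0 →
    Multiset.card (∑ i, C (a i) * g i ^ 2).roots = (∑ i, C (a i) * g i ^ 2).natDegree →
      (∀ x ∈ (∑ i, C (a i) * g i ^ 2).roots, x < 0) →
        (∑ i, C (a i) * g i ^ 2).natDegree + 2 ≤ 2 * ∑ i, (g i).support.card

/-- The rigidity form gives the slice with `c = 2`. -/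
theorem negRooted_of_rigidity (h : NegRootedSOSRigidity) : NegRootedSOS := by
  refine ⟨2, fun s a g hcard hneg => ?_⟩
  by_cases hF : (∑ i, C (a i) * g i ^ 2) = 0
  · rw [hF, natDegree_zero]; exact Nat.zero_le _
  · have hsplit : Multiset.card (∑ i, C (a i) * g i ^ 2).roots = (∑ i, C (a i) * g i ^ 2).natDegree := by
      apply le_antisymm (card_roots' _)
      calc (∑ i, C (a i) * g i ^ 2).natDegree = (∑ i, C (a i) * g i ^ 2).roots.toFinset.card := hcard.symm
        _ ≤ _ := Multiset.toFinset_card_le _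
    have := h s a g hF hsplit hneg
    omega

/-! ### The slice's tools compute: the `s = 1` equality case of the rigidity form, PROVED (Vieta/Newton gap lemma:
a polynomial with only negative roots has no vanishing coefficient below its degree). -/

/-- `∏_{r ∈ s} (X − r)` over NEGATIVE reals `r` has strictly positive coefficients in degrees `≤ #s`. -/
theorem coeff_prod_X_sub_C_pos (s : Multiset ℝ) (hs : ∀ r ∈ s, r < 0) :
    ∀ k, k ≤ Multiset.card s → 0 < ((s.map fun r => X - C r).prod).coeff k := by
  induction s using Multiset.induction_on with
  | empty =>
    intro k hk
    simp only [Multiset.card_zero, Nat.le_zero] at hk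
    subst hk; simp
  | cons r s ih =>
    intro k hk
    have hr : r < 0 := hs r (Multiset.mem_cons_self r s)
    have ih' := ih (fun x hx => hs x (Multiset.mem_cons_of_mem hx))
    have hdeg : ((s.map fun r => X - C r).prod).natDegree = Multiset.card s := by
      rw [natDegree_multiset_prod_X_sub_C_eq_card]
    rw [Multiset.map_cons, Multiset.prod_cons, mul_comm, mul_sub, coeff_sub, coeff_mul_C]
    rw [Multiset.card_cons] at hk
    rcases k with _ | k
    · rw [coeff_mul_X_zero]
      have h0 := ih' 0 (Nat.zero_le _)
      nlinarith
    · rw [coeff_mul_X]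
      have h1 : 0 < ((s.map fun r => X - C r).prod).coeff k := ih' k (by omega)
      have h2 : 0 ≤ ((s.map fun r => X - C r).prod).coeff (k + 1) := by
        by_cases hk' : k + 1 ≤ Multiset.card s
        · exact (ih' (k + 1) hk').le
        · rw [coeff_eq_zero_of_natDegree_lt (by rw [hdeg]; omega)]
      nlinarith [mul_nonneg h2 (neg_nonneg.2 hr.le)]

/-- **Gap lemma (Newton/Vieta).** A real polynomial with all its roots real and negative has no zero coefficient below its
degree, hence `|supp g| = deg g + 1`. -/
theorem card_support_of_negRooted (g : ℝ[X]) (hg : g ≠ 0)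
    (hsplit : Multiset.card g.roots = g.natDegree) (hneg : ∀ x ∈ g.roots, x < 0) :
    g.support.card = g.natDegree + 1 := by
  apply le_antisymm
  · simpa using Finset.card_le_card (supp_subset_range_natDegree_succ (p := g))
  · have hprod := C_leadingCoeff_mul_prod_multiset_X_sub_C hsplit
    have hlc : g.leadingCoeff ≠ 0 := leadingCoeff_ne_zero.2 hg
    have hsub : Finset.range (g.natDegree + 1) ⊆ g.support := by
      intro k hk
      rw [Finset.mem_range] at hk
      rw [mem_support_iff, ← hprod, coeff_C_mul]
      have hpos := coeff_prod_X_sub_C_pos g.roots hneg k (by rw [hsplit]; omega)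
      exact mul_ne_zero hlc hpos.ne'
    simpa using Finset.card_le_card hsub

/-- **Rigidity form, `s = 1` (equality case): PROVED.**  If `a·g²` is nonzero with all roots real and negative then
`deg(a g²) + 2 ≤ 2 |supp g|` (in fact `=`). -/
theorem negRooted_oneSquare_rigidity (a : ℝ) (g : ℝ[X]) (hF : C a * g ^ 2 ≠ 0)
    (hsplit : Multiset.card (C a * g ^ 2).roots = (C a * g ^ 2).natDegree)
    (hneg : ∀ x ∈ (C a * g ^ 2).roots, x < 0) :
    (C a * g ^ 2).natDegree + 2 ≤ 2 * g.support.card := by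
  have ha : a ≠ 0 := by rintro rfl; simp at hF
  have hg : g ≠ 0 := by rintro rfl; simp at hF
  have hroots : (C a * g ^ 2).roots = 2 • g.roots := by rw [roots_C_mul _ ha, roots_pow]
  have hdeg : (C a * g ^ 2).natDegree = 2 * g.natDegree := by rw [natDegree_C_mul ha, natDegree_pow]
  have hsplit' : Multiset.card g.roots = g.natDegree := by
    rw [hroots, hdeg, Multiset.card_nsmul] at hsplit
    omega
  have hneg' : ∀ x ∈ g.roots, x < 0 := fun x hx => hneg x (by rw [hroots, Multiset.mem_nsmul]; exact ⟨two_ne_zero, hx⟩)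
  rw [hdeg, card_support_of_negRooted g hg hsplit' hneg']
  omega

/-! ### The `s = 2` mixed-sign case of the rigidity form, PROVED: `deg(a g₁² − b g₂²) + 4 ≤ 2(|supp g₁| + |supp g₂|)`
(both factors `√a g₁ ∓ √b g₂` are negative-rooted, hence gap-free with coefficients of one sign; comparing the two factors'
coefficients on `supp g₂ ∖ supp g₁` (opposite) and on `supp g₁ ∖ supp g₂` (equal) forces one support inside the other). -/

/-- In a negative-rooted polynomial every coefficient up to the degree has the sign of the leading coefficient. -/
theorem coeff_mul_leadingCoeff_pos (P : ℝ[X]) (hP : P ≠ 0)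
    (hsplit : Multiset.card P.roots = P.natDegree) (hneg : ∀ x ∈ P.roots, x < 0) {k : ℕ} (hk : k ≤ P.natDegree) :
    0 < P.coeff k * P.leadingCoeff := by
  have hprod := C_leadingCoeff_mul_prod_multiset_X_sub_C hsplit
  have hlc : P.leadingCoeff ≠ 0 := leadingCoeff_ne_zero.2 hP
  have hpos := coeff_prod_X_sub_C_pos P.roots hneg k (by rw [hsplit]; exact hk)
  have : P.coeff k = P.leadingCoeff * ((P.roots.map fun r => X - C r).prod).coeff k := by
    conv_lhs => rw [← hprod]
    rw [coeff_C_mul]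
  rw [this]
  nlinarith [mul_pos (mul_self_pos.2 hlc) hpos]

/-- Splitting and negativity pass to the factors of a product. -/
theorem factors_of_negRooted_mul (P Q : ℝ[X]) (hP : P ≠ 0) (hQ : Q ≠ 0)
    (hsplit : Multiset.card (P * Q).roots = (P * Q).natDegree) (hneg : ∀ x ∈ (P * Q).roots, x < 0) :
    (Multiset.card P.roots = P.natDegree ∧ ∀ x ∈ P.roots, x < 0) ∧
    (Multiset.card Q.roots = Q.natDegree ∧ ∀ x ∈ Q.roots, x < 0) := by
  have hPQ : P * Q ≠ 0 := mul_ne_zero hP hQ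
  rw [roots_mul hPQ, Multiset.card_add, natDegree_mul hP hQ] at hsplit
  have h1 := card_roots' P
  have h2 := card_roots' Q
  refine ⟨⟨by omega, fun x hx => hneg x ?_⟩, ⟨by omega, fun x hx => hneg x ?_⟩⟩
  · rw [roots_mul hPQ]; exact Multiset.mem_add.2 (Or.inl hx)
  · rw [roots_mul hPQ]; exact Multiset.mem_add.2 (Or.inr hx)

set_option maxHeartbeats 800000 in
/-- **Rigidity form, `s = 2`, mixed signs: PROVED.**  If `a, b > 0`, `g₁, g₂ ≠ 0` and `a g₁² − b g₂²` is nonzero with all its roots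
real and negative, then `deg + 4 ≤ 2 (|supp g₁| + |supp g₂|)`. -/
theorem negRooted_twoSquares_rigidity (a b : ℝ) (ha : 0 < a) (hb : 0 < b) (g₁ g₂ : ℝ[X])
    (hg₁ : g₁ ≠ 0) (hg₂ : g₂ ≠ 0) (hF : C a * g₁ ^ 2 - C b * g₂ ^ 2 ≠ 0)
    (hsplit : Multiset.card (C a * g₁ ^ 2 - C b * g₂ ^ 2).roots = (C a * g₁ ^ 2 - C b * g₂ ^ 2).natDegree)
    (hneg : ∀ x ∈ (C a * g₁ ^ 2 - C b * g₂ ^ 2).roots, x < 0) :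
    (C a * g₁ ^ 2 - C b * g₂ ^ 2).natDegree + 4 ≤ 2 * (g₁.support.card + g₂.support.card) := by
  -- factorisation
  set α := Real.sqrt a with hα
  set β := Real.sqrt b with hβ
  have hαpos : 0 < α := Real.sqrt_pos.2 ha
  have hβpos : 0 < β := Real.sqrt_pos.2 hb
  have hαa : α * α = a := Real.mul_self_sqrt ha.le
  have hβb : β * β = b := Real.mul_self_sqrt hb.le
  set P := C α * g₁ - C β * g₂ with hPdef
  set Q := C α * g₁ + C β * g₂ with hQdef
  have hfac : C a * g₁ ^ 2 - C b * g₂ ^ 2 = P * Q := by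
    rw [hPdef, hQdef, show C a = C α * C α by rw [← C_mul, hαa], show C b = C β * C β by rw [← C_mul, hβb]]
    ring
  rw [hfac] at hF hsplit hneg ⊢
  have hP : P ≠ 0 := left_ne_zero_of_mul hF
  have hQ : Q ≠ 0 := right_ne_zero_of_mul hF
  obtain ⟨⟨hPs, hPn⟩, ⟨hQs, hQn⟩⟩ := factors_of_negRooted_mul P Q hP hQ hsplit hneg
  have hcardP := card_support_of_negRooted P hP hPs hPn
  have hcardQ := card_support_of_negRooted Q hQ hQs hQn
  rw [natDegree_mul hP hQ]
  -- coefficients of the factors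
  have hcP : ∀ k, P.coeff k = α * g₁.coeff k - β * g₂.coeff k := fun k => by
    rw [hPdef, coeff_sub, coeff_C_mul, coeff_C_mul]
  have hcQ : ∀ k, Q.coeff k = α * g₁.coeff k + β * g₂.coeff k := fun k => by
    rw [hQdef, coeff_add, coeff_C_mul, coeff_C_mul]
  have hT₁ : 1 ≤ g₁.support.card :=
    Finset.card_pos.2 (Finset.nonempty_iff_ne_empty.2 fun h => hg₁ (Polynomial.support_eq_empty.1 h))
  have hT₂ : 1 ≤ g₂.support.card :=
    Finset.card_pos.2 (Finset.nonempty_iff_ne_empty.2 fun h => hg₂ (Polynomial.support_eq_empty.1 h))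
  -- supports of P, Q inside supp g₁ ∪ supp g₂, hence inside the larger one when nested
  have hsubP : P.support ⊆ g₁.support ∪ g₂.support := fun k hk => by
    rw [Finset.mem_union, mem_support_iff, mem_support_iff]
    by_contra h
    push Not at h
    rw [mem_support_iff, hcP, h.1, h.2] at hk
    simp at hk
  have hsubQ : Q.support ⊆ g₁.support ∪ g₂.support := fun k hk => by
    rw [Finset.mem_union, mem_support_iff, mem_support_iff]
    by_contra h
    push Not at h
    rw [mem_support_iff, hcQ, h.1, h.2] at hk
    simp at hk
  by_cases h21 : g₂.support ⊆ g₁.support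
  · have hU : g₁.support ∪ g₂.support = g₁.support := Finset.union_eq_left.2 h21
    rw [hU] at hsubP hsubQ
    have := Finset.card_le_card hsubP
    have := Finset.card_le_card hsubQ
    omega
  by_cases h12 : g₁.support ⊆ g₂.support
  · have hU : g₁.support ∪ g₂.support = g₂.support := Finset.union_eq_right.2 h12
    rw [hU] at hsubP hsubQ
    have := Finset.card_le_card hsubP
    have := Finset.card_le_card hsubQ
    omega
  -- the remaining configuration is contradictory
  exfalso
  obtain ⟨k, hk₂, hk₁⟩ := Finset.not_subset.1 h21
  obtain ⟨k', hk'₁, hk'₂⟩ := Finset.not_subset.1 h12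
  rw [mem_support_iff] at hk₂ hk'₁
  rw [notMem_support_iff] at hk₁ hk'₂
  have ePk : P.coeff k = -(β * g₂.coeff k) := by rw [hcP, hk₁]; ring
  have eQk : Q.coeff k = β * g₂.coeff k := by rw [hcQ, hk₁]; ring
  have ePk' : P.coeff k' = α * g₁.coeff k' := by rw [hcP, hk'₂]; ring
  have eQk' : Q.coeff k' = α * g₁.coeff k' := by rw [hcQ, hk'₂]; ring
  have nzk : β * g₂.coeff k ≠ 0 := mul_ne_zero hβpos.ne' hk₂
  have nzk' : α * g₁.coeff k' ≠ 0 := mul_ne_zero hαpos.ne' hk'₁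
  have degPk : k ≤ P.natDegree := le_natDegree_of_ne_zero (by rw [ePk]; exact neg_ne_zero.2 nzk)
  have degQk : k ≤ Q.natDegree := le_natDegree_of_ne_zero (by rw [eQk]; exact nzk)
  have degPk' : k' ≤ P.natDegree := le_natDegree_of_ne_zero (by rw [ePk']; exact nzk')
  have degQk' : k' ≤ Q.natDegree := le_natDegree_of_ne_zero (by rw [eQk']; exact nzk')
  have s1 := coeff_mul_leadingCoeff_pos P hP hPs hPn degPk
  have s2 := coeff_mul_leadingCoeff_pos Q hQ hQs hQn degQk
  have s3 := coeff_mul_leadingCoeff_pos P hP hPs hPn degPk'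
  have s4 := coeff_mul_leadingCoeff_pos Q hQ hQs hQn degQk'
  rw [ePk] at s1; rw [eQk] at s2; rw [ePk'] at s3; rw [eQk'] at s4
  -- s1, s2 ⟹ lc P · lc Q < 0 ; s3, s4 ⟹ lc P · lc Q > 0
  have m1 : (β * g₂.coeff k * P.leadingCoeff) * (β * g₂.coeff k * Q.leadingCoeff) < 0 :=
    mul_neg_of_neg_of_pos (by linarith) s2
  have m2 : 0 < (α * g₁.coeff k' * P.leadingCoeff) * (α * g₁.coeff k' * Q.leadingCoeff) := mul_pos s3 s4
  have e1 : (β * g₂.coeff k * P.leadingCoeff) * (β * g₂.coeff k * Q.leadingCoeff)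
      = (β * g₂.coeff k) ^ 2 * (P.leadingCoeff * Q.leadingCoeff) := by ring
  have e2 : (α * g₁.coeff k' * P.leadingCoeff) * (α * g₁.coeff k' * Q.leadingCoeff)
      = (α * g₁.coeff k') ^ 2 * (P.leadingCoeff * Q.leadingCoeff) := by ring
  rw [e1] at m1
  rw [e2] at m2
  have hx : 0 < (β * g₂.coeff k) ^ 2 := lt_of_le_of_ne (sq_nonneg _) (Ne.symm (pow_ne_zero 2 nzk))
  have hy : 0 < (α * g₁.coeff k') ^ 2 := lt_of_le_of_ne (sq_nonneg _) (Ne.symm (pow_ne_zero 2 nzk'))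
  have L1 : P.leadingCoeff * Q.leadingCoeff < 0 := by
    by_contra hcon
    push Not at hcon
    have := mul_nonneg hx.le hcon
    linarith
  have L2 : 0 < P.leadingCoeff * Q.leadingCoeff := by
    by_contra hcon
    push Not at hcon
    have := mul_nonpos_of_nonneg_of_nonpos hy.le hcon
    linarith
  linarith

/-! ### The finite sieve theorem (statement only; VERIFIED off-line by exact enumeration, kit j026135/j026290/j026309 —
every exclusion is by coverage, leading-term cancellation, one-signedness of the coefficients or sign parity; to be LANDED by a
`decide`/`native_decide` enumeration over support designs plus `card_support_of_negRooted`).  First landable rung of a line in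
the slice: three squares with at most four monomials each. -/

/-- Rigidity form for three squares of 4-nomials (leading-cancellation depth ≤ 2): if `F = Σ_{i<3} aᵢ gᵢ²` is nonzero with all roots
real and negative, `|supp gᵢ| ≤ 4` and `deg gᵢ ≤ ⌈deg F / 2⌉ + 2` for all `i`, then `deg F + 2 ≤ 2 Σ |supp gᵢ|`. -/
def NegRootedThreeSquaresT4 : Prop :=
  ∀ (a : Fin 3 → ℝ) (g : Fin 3 → ℝ[X]), (∀ i, (g i).support.card ≤ 4) →
    (∑ i, C (a i) * g i ^ 2) ≠ 0 →
    Multiset.card (∑ i, C (a i) * g i ^ 2).roots = (∑ i, C (a i) * g i ^ 2).natDegree →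
      (∀ x ∈ (∑ i, C (a i) * g i ^ 2).roots, x < 0) →
        (∀ i, (g i).natDegree ≤ ((∑ i, C (a i) * g i ^ 2).natDegree + 1) / 2 + 2) →
          (∑ i, C (a i) * g i ^ 2).natDegree + 2 ≤ 2 * ∑ i, (g i).support.card

/-- It is an instance of the general rigidity form (which has no degree-of-gᵢ side condition). -/
theorem negRootedThreeSquaresT4_of_rigidity (h : NegRootedSOSRigidity) : NegRootedThreeSquaresT4 :=
  fun a g _ hF hsplit hneg _ => h 3 a g hF hsplit hneg

/-! ## DECOMPOSITION attempts: first rungs (each strictly weaker than the crux; none composes back) -/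

open Classical in
/-- Positive-coefficient rung: with all coefficients of all `g_i` nonnegative there is no cancellation INSIDE a square on
`(0, ∞)`; only the outer crossing `P = N` of two positively weighted sums of such squares remains (both `log P(e^u)`,
`log N(e^u)` are log-sum-exp functions whose tropicalisations have `≤ S` pieces each). -/
def PosCoeffSOSTau : Prop :=
  ∃ c : ℕ, ∀ (s : ℕ) (a : Fin s → ℝ) (g : Fin s → ℝ[X]), (∀ i n, 0 ≤ (g i).coeff n) →
    ((∑ i, C (a i) * g i ^ 2).roots.toFinset.filter (fun x => 0 < x)).card ≤ c * ∑ i, (g i).support.card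

theorem posCoeff_of_crux (h : Crux) : PosCoeffSOSTau := by
  obtain ⟨c, hc⟩ := h
  exact ⟨c, fun s a g _ => (Finset.card_filter_le _ _).trans (hc s a g)⟩

/-- Common-support rung ("a rank-`s` quadric meets the lacunary moment curve `x ↦ (x^e)_{e ∈ E}` in `≤ c·s·|E|`
points"): interpolates Descartes (`s = 1`) and the trivial sumset bound (`s = |E|`) linearly in the rank. -/
def CommonSupportSOS : Prop :=
  ∃ c : ℕ, ∀ (s : ℕ) (E : Finset ℕ) (a : Fin s → ℝ) (g : Fin s → ℝ[X]), (∀ i, (g i).support ⊆ E) →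
    (∑ i, C (a i) * g i ^ 2).roots.toFinset.card ≤ c * s * E.card

theorem commonSupport_of_crux (h : Crux) : CommonSupportSOS := by
  obtain ⟨c, hc⟩ := h
  refine ⟨c, fun s E a g hE => (hc s a g).trans ?_⟩
  rw [mul_assoc]
  gcongr
  calc ∑ i, (g i).support.card ≤ ∑ _i : Fin s, E.card := Finset.sum_le_sum fun i _ => Finset.card_le_card (hE i)
    _ = s * E.card := by simp

/-! ## NEGATION normal form for three squares: `p² + q² − g² = |p + iq|² − g² = Re((h − g)(h̄ + g))`, `h = p + iq`.
The first open case of the crux is exactly: the modulus of a sparse COMPLEX polynomial and a sparse real polynomial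
cross `O(T)` times on the real line (equivalently the sparse complex rational function `h/g` meets the unit circle
`O(T)` times on `ℝ`).  Typed as the `(+,+,−)` statement; every mixed three-square instance is of this shape up to
a global sign and rescaling. -/

/-- Three squares, signs `(+,+,−)`: `#{x ∈ ℝ : p² + q² = g²} ≤ c (|supp p| + |supp q| + |supp g|)`. -/
def ThreeSquaresPPM : Prop :=
  ∃ c : ℕ, ∀ (p q g : ℝ[X]),
    (p ^ 2 + q ^ 2 - g ^ 2).roots.toFinset.card ≤ c * (p.support.card + q.support.card + g.support.card)

theorem threeSquares_of_crux (h : Crux) : ThreeSquaresPPM := by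
  obtain ⟨c, hc⟩ := h
  refine ⟨c, fun p q g => ?_⟩
  have key := hc 3 ![1, 1, -1] ![p, q, g]
  have hsum : (∑ i : Fin 3, C ((![1, 1, -1] : Fin 3 → ℝ) i) * (![p, q, g] : Fin 3 → ℝ[X]) i ^ 2)
      = p ^ 2 + q ^ 2 - g ^ 2 := by
    simp only [Fin.sum_univ_three, Matrix.cons_val_zero, Matrix.cons_val_one, Matrix.cons_val_two,
      Matrix.tail_cons, Matrix.head_cons, map_one, one_mul, map_neg, neg_mul]
    ring
  have hsupp : (∑ i : Fin 3, ((![p, q, g] : Fin 3 → ℝ[X]) i).support.card)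
      = p.support.card + q.support.card + g.support.card := by
    simp only [Fin.sum_univ_three, Matrix.cons_val_zero, Matrix.cons_val_one, Matrix.cons_val_two,
      Matrix.tail_cons, Matrix.head_cons]
  rw [hsum, hsupp] at key
  exact key

end Summit.ValiantsHypothesis.ValiantsHypothesis.Cruxes.SOSTau.Census2
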